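import Summits.CriticalPhenomena.PercolationContinuityZ3.Theorems.Transplant.PlanarCells2VArm
import Summits.CriticalPhenomena.PercolationContinuityZ3.Theorems.Transplant.PlanarCells2Levels
import HarnessLib

/-!
J23/(R-45) SUCCESSOR `…V` (hp-8 g42, 2026-08-23; rulings lead g12 11:31:15Z, design owner p3-g17 (R-44)/(R-45)): the twin of `PlanarCells2LevelsT` over `PCells2V` (PlanarCells2VDefs:
the slab family `Stub/Zone/Face/Hfull/faceLo/faceHi` has the ASYMMETRIC transverse room `σ·[−hB∥, hF∥]`, `hB, hF ≤ 2r⊥`; every other box verbatim); text VERBATIM with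
`PCells2T ↦ PCells2V` (+ the V-layer renames) except the located slab-room edits (lane 12:42:50Z recipes). NO landed file is edited; `PlanarCells2LevelsT` stays valid (`PCells2T.toV`).

(R-40) SUCCESSOR `…T` (hp-8 g42, 2026-08-23; ruling p3-g16 06:23:56Z, J18): the twin of `PlanarCells2LevelsS` over the PER-AXIS creep cap `PCells2V` (PlanarCells2TDefs:
`c i ≤ r (oth i)` instead of the uniform `c i ≤ cmax ≤ r j`); statements and proofs VERBATIM with `PCells2S ↦ PCells2V` (+ the renames of record of the T layer below it);
the only mathematical touch points are the places that read the cap, which only ever need the cross form `c (oth j) ≤ r j` (listed in the lane line of this file's landing).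
NO landed file is edited; `PlanarCells2LevelsS` stays valid (and is an instance of this file through `PCells2S.toT`). NON-VACUITY: inherited verbatim from `PlanarCells2LevelsS` (same witness line).

# STAGGERED two-unit planar cells `PCells2V`: LEVELS — the `PCells2V` twin of `PlanarCells2Levels` (levels along a macro-direction about the
# staggered centre, the level data of `Q / H / H^j / F^j / M_{v+δ}` and of the arms / far regions OF RECORD `BtwNS`, `FarNS` ((R-27)/(R-29)), the
# enlarged face row, and the planar bounds / square envelopes about `cenS`)

WAVE-1 Geom re-base (typer p3-g15).  Levels are along-axis, so every proof is hp-8 g28's with `cen ↦ cenS` (stmt-g19's GEOM-REBASE-PRECENSUS §C);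
what is NEW is only the re-targeting of the far-region lemmas to the far region of record `FarNS = BtwNS ∪ QNS v δ 1` (whose far block follows the
neighbour: along `[15r, 25r]` exactly by `PCells2T.cenS_add_stepVec_fst`, across shifted by the creep — irrelevant for levels) and of the between-box lemmas to
`BtwNS`; the one-box `Efar/EfarN/farAN/farAS` versions are kept where true verbatim (the fresh rows' re-cut is the FaceRows twin's business).
Statements in explicit-application form `PCells2V.X P …`.
builds on p205010 (kernel theorem, internal audit signed; external expert review pending) — nothing here uses p205010 or claims anything about the open node.
Lane `prim-bschramm`, seat `prim-bschramm-p3` (gen 15; N2 design owner); helper file (`--supports stmt-CriticalPhenomena-4575 --as helper`).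
[cite: KozmaNitzan2024, §4 pp. 26, 30]
-/

noncomputable section

namespace Summit.CriticalPhenomena.PercolationContinuityZ3.Theorems

namespace Transplant

open Literature.Probability.Percolation Literature.Probability.LatticeModels SimpleGraph GadgetSystem Contour
open Literature.Probability.Percolation.KozmaNitzan
open Literature.Probability.Percolation.KozmaNitzan.Cells (oth oth_ne sgOf sgOf_sign stepVec_apply_fst stepVec_apply_oth eq_oth_of_ne oth_oth
  eq_of_coords)
open PCells (mem_psBox_iff)

namespace PCells2V

variable (P : PCells2V)

/-! ## Levels -/

/-- The level, unfolded. [folklore] -/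
theorem lev_def (δ : MDir) (v t : Site 2) : PCells2V.lev P δ v t = sgOf δ * (t δ.1 - P.cenS v δ.1) := rfl

/-- A lattice step changes the level by at most one. [folklore] -/
theorem lev_adj (δ : MDir) (v : Site 2) {t t' : Site 2} (h : (zdGraph 2).Adj t t') :
    PCells2V.lev P δ v t' = PCells2V.lev P δ v t ∨ PCells2V.lev P δ v t' = PCells2V.lev P δ v t + 1 ∨ PCells2V.lev P δ v t' = PCells2V.lev P δ v t - 1 := by
  unfold lev
  rcases level_adj (a := δ.1) (sgOf_sign δ) (P.cenS v) h with ⟨h1, -⟩ | ⟨h1, -⟩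
  · exact Or.inl h1
  · rcases h1 with h1 | h1
    · exact Or.inr (Or.inl h1)
    · exact Or.inr (Or.inr h1)

/-- **Levels move by at most one along any step that moves the planar coordinates by at most one** (the `lip` form of `lev_adj`, for
skeletons with diagonal edges). [folklore] -/
theorem lev_le_lev_add_one_of_abs_sub_le_one {δ : MDir} (v : Site 2) {t t' : Site 2} (h : |t' δ.1 - t δ.1| ≤ 1) :
    PCells2V.lev P δ v t' ≤ PCells2V.lev P δ v t + 1 := by
  unfold lev
  rw [abs_le] at h
  rcases sgOf_sign δ with hs | hs <;> rw [hs] <;> omega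

/-- Points of `Q_v` have level at most `5r∥`. [folklore] -/
theorem lev_le_of_mem_Q {δ : MDir} {v t : Site 2} (ht : t ∈ PCells2V.Q P v) : PCells2V.lev P δ v t ≤ 5 * P.r δ.1 := by
  rw [Q, mem_aboxS_iff] at ht
  have h := ht δ.1; push_cast at h
  unfold lev; rcases sgOf_sign δ with hs | hs <;> rw [hs] <;> omega

/-- Points of `Q_v` have level at least `−5r∥`. [folklore] -/
theorem neg_le_lev_of_mem_Q {δ : MDir} {v t : Site 2} (ht : t ∈ PCells2V.Q P v) : -(5 * (P.r δ.1 : ℤ)) ≤ PCells2V.lev P δ v t := by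
  rw [Q, mem_aboxS_iff] at ht
  have h := ht δ.1; push_cast at h
  unfold lev; rcases sgOf_sign δ with hs | hs <;> rw [hs] <;> omega

/-- Points of the far region of record `FarNS v δ = BtwNS ∪ QNS v δ 1` have level at least `5r∥ + 1` (the `QNS` block starts at level `15r∥`,
`PCells2T.cenS_add_stepVec_fst`). [folklore] -/
theorem lev_ge_of_mem_FarNS {δ : MDir} {v t : Site 2} (ht : t ∈ PCells2V.FarNS P v δ) : 5 * (P.r δ.1 : ℤ) + 1 ≤ PCells2V.lev P δ v t := by
  rw [FarNS, Finset.mem_union] at ht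
  unfold lev
  rcases ht with ht | ht
  · rw [mem_BtwNS_iff] at ht; exact ht.1.1
  · rw [mem_QNS_iff, P.cenS_add_stepVec_fst] at ht
    have h := ht.1.1
    have hr := P.one_le_r δ.1
    rcases sgOf_sign δ with hs | hs <;> rw [hs] at h ⊢ <;> nlinarith

/-- Points of `FarNS v δ` have level at most `25 r∥`. [folklore] -/
theorem lev_le_of_mem_FarNS {δ : MDir} {v t : Site 2} (ht : t ∈ PCells2V.FarNS P v δ) : PCells2V.lev P δ v t ≤ 25 * P.r δ.1 := by
  rw [FarNS, Finset.mem_union] at ht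
  unfold lev
  rcases ht with ht | ht
  · rw [mem_BtwNS_iff] at ht; have := ht.1.2; omega
  · rw [mem_QNS_iff, P.cenS_add_stepVec_fst] at ht
    have h := ht.1.2
    rcases sgOf_sign δ with hs | hs <;> rw [hs] at h ⊢ <;> nlinarith

/-- Points of the corridor `H_{v,δ}` have level in `[5r∥, 22r∥]`. [folklore] -/
theorem lev_mem_of_mem_Hfull {δ : MDir} {v t : Site 2} (ht : t ∈ PCells2V.Hfull P v δ) : 5 * (P.r δ.1 : ℤ) ≤ PCells2V.lev P δ v t ∧ PCells2V.lev P δ v t ≤ 22 * P.r δ.1 := by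
  rw [Hfull, mem_psBoxA_iff] at ht; exact ht.1

/-- A corridor point of level `≥ 5r∥ + 1` lies in the far region of record (`Hfull ⊆ Q ∪ FarNS`, and `Q` has level `≤ 5r∥`). [folklore] -/
theorem mem_FarNS_of_mem_Hfull {δ : MDir} {v t : Site 2} (ht : t ∈ PCells2V.Hfull P v δ) (hl : 5 * (P.r δ.1 : ℤ) + 1 ≤ PCells2V.lev P δ v t) :
    t ∈ PCells2V.FarNS P v δ := by
  rcases Finset.mem_union.1 (P.Hfull_subset_Q_union_FarNS v δ ht) with h | h
  · have := P.lev_le_of_mem_Q (δ := δ) h; omega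
  · exact h

/-- A point of the corridor `H_{v,δ}` NOT of level `> L` inside `FarNS` has level `≤ L` (`5r∥ ≤ L`). [folklore] -/
theorem lev_le_of_mem_Hfull_of_not_past_FarNS {δ : MDir} {v t : Site 2} (ht : t ∈ PCells2V.Hfull P v δ) {L : ℤ} (hL : 5 * (P.r δ.1 : ℤ) ≤ L)
    (hn : ¬(t ∈ PCells2V.FarNS P v δ ∧ L + 1 ≤ PCells2V.lev P δ v t)) : PCells2V.lev P δ v t ≤ L := by
  by_contra hlt
  push Not at hlt
  exact hn ⟨P.mem_FarNS_of_mem_Hfull ht (by omega), by omega⟩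

/-- A corridor point off the far region of record has level `≤ 5r∥`. [folklore] -/
theorem lev_le_of_mem_Hfull_not_FarNS' {δ : MDir} {v t : Site 2} (ht : t ∈ PCells2V.Hfull P v δ) (hn : t ∉ PCells2V.FarNS P v δ) :
    PCells2V.lev P δ v t ≤ 5 * P.r δ.1 :=
  P.lev_le_of_mem_Hfull_of_not_past_FarNS ht le_rfl fun h => hn h.1

/-- A corridor point of level `≤ 5r∥ + 10s∥j` lies in the stub `H^j`. [folklore] -/
theorem mem_Stub_of_mem_Hfull {δ : MDir} {v t : Site 2} (ht : t ∈ PCells2V.Hfull P v δ) {j : ℕ} (hl : PCells2V.lev P δ v t ≤ 5 * P.r δ.1 + 10 * P.s δ.1 * j) :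
    t ∈ PCells2V.Stub P v δ j := by
  rw [Hfull, mem_psBoxA_iff] at ht
  rw [Stub, mem_psBoxA_iff]
  unfold lev at hl
  exact ⟨⟨ht.1.1, hl⟩, ht.2⟩

/-- A corridor point of level exactly `5r∥ + 10s∥j` lies on the face `F^j`. [folklore] -/
theorem mem_Face_of_mem_Hfull {δ : MDir} {v t : Site 2} (ht : t ∈ PCells2V.Hfull P v δ) {j : ℕ} (hl : PCells2V.lev P δ v t = 5 * P.r δ.1 + 10 * P.s δ.1 * j) :
    t ∈ PCells2V.Face P v δ j := by
  rw [Hfull, mem_psBoxA_iff] at ht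
  rw [Face, mem_psBoxA_iff]
  unfold lev at hl
  exact ⟨⟨hl.ge, hl.le⟩, ht.2⟩

/-- Points of the stub `H^j` have level in `[5r∥, 5r∥ + 10 s∥ j]`. [folklore] -/
theorem lev_mem_of_mem_Stub {δ : MDir} {v t : Site 2} {j : ℕ} (ht : t ∈ PCells2V.Stub P v δ j) :
    5 * (P.r δ.1 : ℤ) ≤ PCells2V.lev P δ v t ∧ PCells2V.lev P δ v t ≤ 5 * P.r δ.1 + 10 * P.s δ.1 * j := by
  rw [Stub, mem_psBoxA_iff] at ht; exact ht.1

/-- Points of the face `F^j` have level exactly `5r∥ + 10 s∥ j`. [folklore] -/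
theorem lev_eq_of_mem_Face {δ : MDir} {v t : Site 2} {j : ℕ} (ht : t ∈ PCells2V.Face P v δ j) : PCells2V.lev P δ v t = 5 * P.r δ.1 + 10 * P.s δ.1 * j := by
  rw [Face, mem_psBoxA_iff] at ht; unfold lev; exact le_antisymm ht.1.2 ht.1.1

/-- Points of `M_{v+δ}` have level at least `17 r∥`. [folklore] -/
theorem lev_ge_of_mem_M_add {δ : MDir} {v t : Site 2} (ht : t ∈ PCells2V.M P (v + stepVec δ)) : 17 * (P.r δ.1 : ℤ) ≤ PCells2V.lev P δ v t := by
  rw [M, mem_aboxS_iff] at ht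
  have h := ht δ.1
  rw [P.cenS_add_stepVec_fst] at h
  push_cast at h
  unfold lev; rcases sgOf_sign δ with hs | hs <;> rw [hs] at h ⊢ <;> omega

/-- Points of `M_{v+δ}` have level at most `23 r∥`. [folklore] -/
theorem lev_le_of_mem_M_add {δ : MDir} {v t : Site 2} (ht : t ∈ PCells2V.M P (v + stepVec δ)) : PCells2V.lev P δ v t ≤ 23 * P.r δ.1 := by
  rw [M, mem_aboxS_iff] at ht
  have h := ht δ.1
  rw [P.cenS_add_stepVec_fst] at h
  push_cast at h
  unfold lev; rcases sgOf_sign δ with hs | hs <;> rw [hs] at h ⊢ <;> omega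

/-- The level from the target, seen from the source: `lev δ v t = lev δ (v+δ) t + 20 r∥`. [folklore] -/
theorem lev_eq_lev_add_stepVec (δ : MDir) (v t : Site 2) : PCells2V.lev P δ v t = PCells2V.lev P δ (v + stepVec δ) t + 20 * P.r δ.1 := by
  unfold lev
  rw [P.cenS_add_stepVec_fst]
  rcases sgOf_sign δ with hs | hs <;> rw [hs] <;> ring

/-! ### The fresh rows and the faces -/

/-- A corridor point of level `≥ 5r∥ + 10 s∥ j + 1` lies in the narrow fresh rows `farAN x du j`. [folklore] -/
theorem mem_farAN_of_mem_Hfull {du : MDir} {x t : Site 2} (ht : t ∈ PCells2V.Hfull P x du) {j : ℕ}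
    (hl : 5 * (P.r du.1 : ℤ) + 10 * P.s du.1 * j + 1 ≤ PCells2V.lev P du x t) : t ∈ PCells2V.farAN P x du j := by
  rw [Hfull, mem_psBoxA_iff] at ht
  have hac := P.across_2r_of_signed ht.2.1 ht.2.2
  rw [farAN, mem_psBox_iff]
  unfold lev at hl
  have := P.one_le_r (oth du.1)
  exact ⟨⟨hl, by omega⟩, by omega, by omega⟩

/-- `F^{j+1}` lies in the far region of record, beyond level `5r∥ + 10s∥j` (`j + 1 ≤ K`). [folklore] -/
theorem Face_far_FarNS' {δ : MDir} {v t : Site 2} {j : ℕ} (hjK : j + 1 ≤ P.K) (ht : t ∈ PCells2V.Face P v δ (j + 1)) :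
    t ∈ PCells2V.FarNS P v δ ∧ 5 * (P.r δ.1 : ℤ) + 10 * P.s δ.1 * j + 1 ≤ PCells2V.lev P δ v t := by
  have hlev := P.lev_eq_of_mem_Face ht
  have hs1 : (1 : ℤ) ≤ P.s δ.1 := by exact_mod_cast P.hs δ.1
  have hH : t ∈ PCells2V.Hfull P v δ := P.Stub_subset_Hfull v δ hjK (P.Face_subset_Stub v δ (j + 1) ht)
  have hl : 5 * (P.r δ.1 : ℤ) + 10 * P.s δ.1 * j + 1 ≤ PCells2V.lev P δ v t := by rw [hlev]; push_cast; nlinarith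
  exact ⟨P.mem_FarNS_of_mem_Hfull hH (by nlinarith), hl⟩

/-! ## The enlarged face row -/

/-- **The `k`-enlargement of the face row `F^{j+1}` lies in `farAN`** when `j + 1 ≤ K`, `k + 2 ≤ 10 s∥` (level room below and above) and
`k + 1 ≤ 3 r⊥` (transverse room `2r⊥ + k ≤ 5r⊥ − 1`; with one unit this followed from `k ≤ 10s − 2 ≤ r/2`, with two units it is a
separate hypothesis). [cite: KozmaNitzan2024, §4 p. 30 (the levels above F^{j+1})] -/
theorem Face_enlarge_subset_farAN (x : Site 2) (du : MDir) {j k : ℕ} (hj : j + 1 ≤ P.K) (hk : k + 2 ≤ 10 * P.s du.1)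
    (hk' : k + 1 ≤ 3 * P.r (oth du.1)) :
    Finset.Icc (PCells2V.faceLo P x du j - (k : Site 2)) (PCells2V.faceHi P x du j + (k : Site 2)) ⊆ PCells2V.farAN P x du j := by
  rw [faceLo, faceHi, sBoxA_enlarge _ _ (sgOf_sign du), farAN]
  have hsj : (P.s du.1 : ℤ) * (j + 1) ≤ P.r du.1 := by
    have h := Nat.mul_le_mul_left (P.s du.1) hj
    rw [Nat.mul_comm (P.s du.1) P.K] at h
    exact_mod_cast (show P.s du.1 * (j + 1) ≤ P.r du.1 from h)
  have h20 := P.twenty_mul_s_le_r du.1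
  unfold PCells2.faceL
  refine (sBoxA_subset_sBox (sgOf_sign du) _ _ _ ?_ ?_).trans (sBox_mono (sgOf_sign du) _ ?_ ?_ le_rfl)
  · have := P.hB_le' du.1; omega
  · have := P.hF_le' du.1; omega
  all_goals push_cast; nlinarith [P.one_le_r du.1, P.hs du.1]

/-- The face row `F^{j+1}` itself (the `0`-enlargement) lies in `farAS x du j` when `j + 1 ≤ K` (levels: `5r∥+10s∥j+2 ≤ faceL ≤ 25r∥−1`
as `10 s∥ ≥ 3`; transversally `2r⊥ ≤ 5r⊥ − 2`). [cite: KozmaNitzan2024, §4 p. 30] -/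
theorem faceRow_subset_farAS (x : Site 2) (du : MDir) {j : ℕ} (hj : j + 1 ≤ P.K) :
    Finset.Icc (PCells2V.faceLo P x du j) (PCells2V.faceHi P x du j) ⊆ PCells2V.farAS P x du j := by
  rw [Icc_faceLo_faceHi, farAS]
  have hsj : (P.s du.1 : ℤ) * (j + 1) ≤ P.r du.1 := by
    have h := Nat.mul_le_mul_left (P.s du.1) hj
    rw [Nat.mul_comm (P.s du.1) P.K] at h
    exact_mod_cast (show P.s du.1 * (j + 1) ≤ P.r du.1 from h)
  unfold PCells2.faceL
  refine (sBoxA_subset_sBox (sgOf_sign du) _ _ _ ?_ ?_).trans (sBox_mono (sgOf_sign du) _ ?_ ?_ le_rfl)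
  · have := P.hB_le' du.1; have := P.one_le_r (oth du.1); omega
  · have := P.hF_le' du.1; have := P.one_le_r (oth du.1); omega
  all_goals (push_cast; nlinarith [P.one_le_r du.1, P.hs du.1, P.one_le_r (oth du.1)])

/-! ## Planar bounds -/

/-- A crude planar bound: a point of `EwvNS_{w,δ}` is within `35 r_i` of the centre of `w + δ` in coordinate `i`. [folklore] -/
theorem sub_cenS_le_of_mem_EwvNS {w : Site 2} {δ : MDir} {t : Site 2} (ht : t ∈ PCells2V.EwvNS P w δ) (i : Fin 2) :
    |t i - P.cenS (w + stepVec δ) i| ≤ 35 * P.r i := by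
  rw [EwvNS, Finset.mem_union] at ht
  have hf := P.cenS_add_stepVec_fst w δ
  have ho := P.cenS_add_stepVec_oth w δ
  have hg := P.sg_c_bound δ
  have hc := P.c_nonneg δ.1
  rw [abs_le]
  rcases ht with ht | ht
  · rw [mem_BtwNS_iff] at ht
    obtain ⟨⟨h1, h2⟩, h3, h4⟩ := ht
    rcases eq_or_ne i δ.1 with rfl | hi
    · have hr1 : (1 : ℤ) ≤ P.r δ.1 := by exact_mod_cast P.one_le_r δ.1
      rw [hf]; rcases sgOf_sign δ with hs | hs <;> rw [hs] at h1 h2 ⊢ <;> constructor <;> nlinarith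
    · have hr1 : (1 : ℤ) ≤ P.r (oth δ.1) := by exact_mod_cast P.one_le_r (oth δ.1)
      rw [eq_oth_of_ne hi, ho]; constructor <;> linarith [hg.1, hg.2]
  · rw [Q, mem_aboxS_iff] at ht
    have hr1 : (0 : ℤ) ≤ P.r i := by positivity
    have := ht i; push_cast at this; constructor <;> linarith

/-- `Q v ⊆ cen v + Λ_{5·rmax}`. [folklore] -/
theorem Q_subset_box_image (v : Site 2) : PCells2V.Q P v ⊆ (box 2 (5 * P.rmax)).image (fun s => s + P.cenS v) :=
  P.toPCells2.abox_subset_box_image (P.cenS v) 5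

/-- `Cell v ⊆ cen v + Λ_{10·rmax}`. [folklore] -/
theorem Cell_subset_box_image (v : Site 2) : PCells2V.Cell P v ⊆ (box 2 (10 * P.rmax)).image (fun s => s + P.cenS v) :=
  P.toPCells2.abox_subset_box_image (P.cenS v) 10

/-- `EfarN(x, du) ⊆ cen x + [±25r₀] × [±25r₁]`. [folklore] -/
theorem EfarN_subset_abox (x : Site 2) (du : MDir) : PCells2V.EfarN P x du ⊆ Finset.Icc (P.cenS x - P.hw 25) (P.cenS x + P.hw 25) := by
  intro t ht
  rw [EfarN, mem_psBox_iff] at ht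
  rw [mem_aboxS_iff]
  intro i
  push_cast
  by_cases hi : i = du.1
  · subst hi
    rcases sgOf_sign du with hs | hs <;> rw [hs] at ht <;> constructor <;> nlinarith [ht.1.1, ht.1.2, P.one_le_r du.1]
  · rw [eq_oth_of_ne hi]; constructor <;> linarith [ht.2.1, ht.2.2, P.one_le_r (oth du.1)]

/-- `Hfull(x, du) ⊆ cen x + [±25r₀] × [±25r₁]`. [folklore] -/
theorem Hfull_subset_abox (x : Site 2) (du : MDir) : PCells2V.Hfull P x du ⊆ Finset.Icc (P.cenS x - P.hw 25) (P.cenS x + P.hw 25) := by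
  intro t ht
  rw [Hfull, mem_psBoxA_iff] at ht
  rw [mem_aboxS_iff]
  intro i
  push_cast
  by_cases hi : i = du.1
  · subst hi
    rcases sgOf_sign du with hs | hs <;> rw [hs] at ht <;> constructor <;> nlinarith [ht.1.1, ht.1.2, P.one_le_r du.1]
  · rw [eq_oth_of_ne hi]; constructor <;> linarith [(P.across_2r_of_signed ht.2.1 ht.2.2).1, (P.across_2r_of_signed ht.2.1 ht.2.2).2, P.one_le_r (oth du.1)]

/-- `BtwN v δ ⊆ cen (v + δ) + [±25r₀] × [±25r₁]` (the narrow between-box seen from the target cell). [folklore] -/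
theorem BtwN_subset_abox_tgt (v : Site 2) (δ : MDir) :
    PCells2V.BtwN P v δ ⊆ Finset.Icc (P.cenS (v + stepVec δ) - P.hw 25) (P.cenS (v + stepVec δ) + P.hw 25) := by
  intro t ht
  rw [BtwN, mem_psBox_iff] at ht
  rw [mem_aboxS_iff]
  intro i
  push_cast at ht ⊢
  by_cases hi : i = δ.1
  · subst hi
    rw [P.cenS_add_stepVec_fst]
    rcases sgOf_sign δ with hs | hs <;> rw [hs] at ht ⊢ <;> constructor <;> nlinarith [ht.1.1, ht.1.2, P.one_le_r δ.1]
  · have hg := P.sg_c_bound δ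
    rw [eq_oth_of_ne hi, P.cenS_add_stepVec_oth]; constructor <;> linarith [ht.2.1, ht.2.2, P.one_le_r (oth δ.1), hg.1, hg.2]

/-- `Btw v δ ⊆ cen (v + δ) + [±25r₀] × [±25r₁]`. [folklore] -/
theorem Btw_subset_abox_tgt (v : Site 2) (δ : MDir) :
    PCells2V.Btw P v δ ⊆ Finset.Icc (P.cenS (v + stepVec δ) - P.hw 25) (P.cenS (v + stepVec δ) + P.hw 25) := by
  intro t ht
  rw [Btw, mem_psBox_iff] at ht
  rw [mem_aboxS_iff]
  intro i
  push_cast at ht ⊢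
  by_cases hi : i = δ.1
  · subst hi
    rw [P.cenS_add_stepVec_fst]
    rcases sgOf_sign δ with hs | hs <;> rw [hs] at ht ⊢ <;> constructor <;> nlinarith [ht.1.1, ht.1.2, P.one_le_r δ.1]
  · have hg := P.sg_c_bound δ
    rw [eq_oth_of_ne hi, P.cenS_add_stepVec_oth]; constructor <;> linarith [ht.2.1, ht.2.2, P.one_le_r (oth δ.1), hg.1, hg.2]

/-- `farAN(x, du, j) ⊆ cen x + [±25r₀] × [±25r₁]`. [folklore] -/
theorem farAN_subset_abox (x : Site 2) (du : MDir) (j : ℕ) : PCells2V.farAN P x du j ⊆ Finset.Icc (P.cenS x - P.hw 25) (P.cenS x + P.hw 25) :=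
  (P.farAN_subset_EfarN x du j).trans (P.EfarN_subset_abox x du)

/-- `EfarN(x, du) ⊆ cen x + Λ_{25·rmax}` (square envelope). [folklore] -/
theorem EfarN_subset_box_image (x : Site 2) (du : MDir) : PCells2V.EfarN P x du ⊆ (box 2 (25 * P.rmax)).image (fun s => s + P.cenS x) :=
  (P.EfarN_subset_abox x du).trans (P.toPCells2.abox_subset_box_image (P.cenS x) 25)

/-- `Hfull(x, du) ⊆ cen x + Λ_{25·rmax}`. [folklore] -/
theorem Hfull_subset_box_image (x : Site 2) (du : MDir) : PCells2V.Hfull P x du ⊆ (box 2 (25 * P.rmax)).image (fun s => s + P.cenS x) :=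
  (P.Hfull_subset_abox x du).trans (P.toPCells2.abox_subset_box_image (P.cenS x) 25)

/-- `BtwN v δ ⊆ cen (v + δ) + Λ_{25·rmax}`. [folklore] -/
theorem BtwN_subset_box_image_tgt (v : Site 2) (δ : MDir) :
    PCells2V.BtwN P v δ ⊆ (box 2 (25 * P.rmax)).image (fun s => s + P.cenS (v + stepVec δ)) :=
  (P.BtwN_subset_abox_tgt v δ).trans (P.toPCells2.abox_subset_box_image _ 25)

/-- `Btw v δ ⊆ cen (v + δ) + Λ_{25·rmax}`. [folklore] -/
theorem Btw_subset_box_image_tgt (v : Site 2) (δ : MDir) :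
    PCells2V.Btw P v δ ⊆ (box 2 (25 * P.rmax)).image (fun s => s + P.cenS (v + stepVec δ)) :=
  (P.Btw_subset_abox_tgt v δ).trans (P.toPCells2.abox_subset_box_image _ 25)

/-- `farAN(x, du, j) ⊆ cen x + Λ_{25·rmax}`. [folklore] -/
theorem farAN_subset_box_image (x : Site 2) (du : MDir) (j : ℕ) : PCells2V.farAN P x du j ⊆ (box 2 (25 * P.rmax)).image (fun s => s + P.cenS x) :=
  (P.farAN_subset_EfarN x du j).trans (P.EfarN_subset_box_image x du)

/-- `farAS(x, du, j) ⊆ cen x + Λ_{25·rmax}`. [folklore] -/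
theorem farAS_subset_box_image (x : Site 2) (du : MDir) (j : ℕ) : PCells2V.farAS P x du j ⊆ (box 2 (25 * P.rmax)).image (fun s => s + P.cenS x) :=
  (P.farAS_subset_farAN x du j).trans (P.farAN_subset_box_image x du j)

/-- `probeWorldN v δ du ⊆ cen (v + δ) + Λ_{25·rmax}`. [folklore] -/
theorem probeWorldN_subset_box_image (v : Site 2) (δ du : MDir) :
    PCells2V.probeWorldN P v δ du ⊆ (box 2 (25 * P.rmax)).image (fun s => s + P.cenS (v + stepVec δ)) := by
  rw [probeWorldN]
  refine Finset.union_subset (Finset.union_subset (P.BtwN_subset_box_image_tgt v δ) ?_) (P.Hfull_subset_box_image _ du)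
  exact (P.Q_subset_box_image _).trans (Finset.image_subset_image (box_mono 2 (Nat.mul_le_mul_right P.rmax (by norm_num))))

/-- `FarNS(x, du) ⊆ cenS x + [±25r₀] × [±25r₁]` (the `QNS` block is shifted across by the creep `c ≤ r⊥`). [folklore] -/
theorem FarNS_subset_abox (x : Site 2) (du : MDir) :
    PCells2V.FarNS P x du ⊆ Finset.Icc (P.cenS x - P.hw 25) (P.cenS x + P.hw 25) := by
  refine Finset.union_subset ((P.BtwNS_subset_BtwN x du).trans ((P.BtwN_subset_EfarN x du).trans (P.EfarN_subset_abox x du))) ?_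
  intro t ht
  rw [mem_QNS_iff, P.cenS_add_stepVec_fst, P.cenS_add_stepVec_oth] at ht
  have hg := P.sg_c_bound du
  rw [mem_aboxS_iff]
  intro i
  push_cast at ht ⊢
  by_cases hi : i = du.1
  · subst hi
    rcases sgOf_sign du with hs | hs <;> rw [hs] at ht <;> constructor <;> nlinarith [ht.1.1, ht.1.2, P.one_le_r du.1]
  · rw [eq_oth_of_ne hi]; constructor <;> linarith [ht.2.1, ht.2.2, P.one_le_r (oth du.1), hg.1, hg.2]

/-- `FarNS(x, du) ⊆ cenS x + Λ_{25·rmax}`. [folklore] -/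
theorem FarNS_subset_box_image (x : Site 2) (du : MDir) :
    PCells2V.FarNS P x du ⊆ (box 2 (25 * P.rmax)).image (fun s => s + P.cenS x) :=
  (P.FarNS_subset_abox x du).trans (P.toPCells2.abox_subset_box_image (P.cenS x) 25)

/-- `BtwNS v δ ⊆ cenS (v + δ) + Λ_{25·rmax}`. [folklore] -/
theorem BtwNS_subset_box_image_tgt (v : Site 2) (δ : MDir) :
    PCells2V.BtwNS P v δ ⊆ (box 2 (25 * P.rmax)).image (fun s => s + P.cenS (v + stepVec δ)) :=
  (P.BtwNS_subset_BtwN v δ).trans (P.BtwN_subset_box_image_tgt v δ)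

/-- `probeWorldNS v δ du ⊆ cenS (v + δ) + Λ_{25·rmax}`. [folklore] -/
theorem probeWorldNS_subset_box_image (v : Site 2) (δ du : MDir) :
    PCells2V.probeWorldNS P v δ du ⊆ (box 2 (25 * P.rmax)).image (fun s => s + P.cenS (v + stepVec δ)) :=
  (P.probeWorldNS_subset_probeWorldN v δ du).trans (P.probeWorldN_subset_box_image v δ du)

end PCells2V

end Transplant

end Summit.CriticalPhenomena.PercolationContinuityZ3.Theorems

end
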